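import Mathlib
import HarnessLib
import Summits.Langlands.Langlands.Theorems.ExteriorSquareAscentSelfTwistedIrreducibleDefs
import Summits.Langlands.Langlands.Theorems.ExteriorSquareAscentSelfTwistedIrreducibleStubPinnedDoublingKillAux2
import Literature.NumberTheory.Automorphic.TunnellOctahedralGlobal
import Literature.NumberTheory.Automorphic.GaloisActionPlaces
import Literature.NumberTheory.Automorphic.AsaiSign
import Literature.NumberTheory.Automorphic.BockleHuiIrreducibleGL3WeightProofs
import Literature.NumberTheory.Automorphic.AutomorphicRepsGLSatakeFlathProofs
import Literature.NumberTheory.Automorphic.GLOneOfHeckeCharacterBJ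
import Literature.NumberTheory.GaloisRepresentations.HeckeLFunctionNonvanishingLineProofs
import Literature.NumberTheory.GaloisRepresentations.HeckeCharacterNormTwistProofs
import Literature.NumberTheory.GaloisRepresentations.HeckeCharacterCofiniteProofs

/-!
# Crux `SelfTwistedIrreducible` (stmt-Langlands-18055), line `Sketch`: stub `stub_pinnedDoublingKill`

Over the quadratic `L/K` with non-trivial automorphism `τ`, let `f` be cuspidal on `GL₂/L` and `χ`
a Hecke character of `L` PINNING A DOUBLING of `f` along `τ` (`HasPinnedDoubling τ f χ`: at almost
every place `w`, `t_{f,w} ⊔ t_{f,τw} = {x, x, y, y}` and `χ(ϖ_w) = q_w³ · x y`).  Then `f` is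
Galois-stable at Satake level (`IsGaloisStableSatakeAE K f.1`: `t_{f,τw} = t_{f,w}` a.e.).

Proof (idea det-pinning).  Normalise `t_{f,w} = q_w^s α(w)` with `α` the Satake family of a unitary
`Π ≤ L²_cusp(GL₂)` off a finite set (`CuspidalAutomorphicRepData.exists_normalisation_L2`), let `Ω` be
the central character at Satake level (`centralCharacter_satake_of_cuspidal`, `Ω(ϖ_w) = det t_{f,w}`)
and `ν := χ · ‖·‖³ · Ω⁻¹`.  At a good place two size-two multisets with sum `{x, x, y, y}` are either
EQUAL (`{a, b}` twice, `a b = x y`) or SCALAR AND DISTINCT (`{a, a}`, `{b, b}`, `a ≠ b`, `a b = x y`)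
(`doubling_dichotomy`); accordingly `ν(ϖ_w) = x y / det t_{f,w}` is `1`, or `b/a ≠ 1` of modulus
`1` (`|a|² = |q_w^s|² = |b|²` by unitarity of `Π`, `q_{τw} = q_w`) with `α(w)` scalar
(`place_analysis`).  So `ν` is unitary (`|ν| = ‖·‖^σ` with `q_w^{-σ} = 1`), unramified off a finite
set, and non-trivial only at scalar places of `Π`: by the density contradiction
`eq_one_of_scalar_at_ne_one` (Hecke: `{ν(ϖ_w) ≠ 1}` carries `≥ ½` of `Σ q_w^{-σ}`; Rankin–Selberg with
the PROVED rank-two pole: the scalar places carry `≤ ¼`), `ν = 1`, i.e. every good place is of the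
first kind, `t_{f,τw} = t_{f,w}`.  Finally the places of `L` over a place of `K` are `{w, τw}`
(`HeightOneSpectrum.eq_or_eq_smul_of_under_eq`).
-/

noncomputable section

set_option linter.dupNamespace false -- `Summit.Langlands.Langlands` is the mandated namespace

namespace Summit.Langlands.Langlands.Cruxes.SelfTwistedIrreducible.DetPinning

open scoped NumberField Polynomial Classical
open Filter Polynomial NumberField IsDedekindDomain Field
open Literature.NumberTheory.GaloisRepresentations Literature.NumberTheory.Automorphic

/-! ### Multisets: the dichotomy at one place -/

/-- Counting `x` in `{a, b, c, d}`. [folklore] -/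
theorem count_four (x a b c d : ℂ) :
    Multiset.count x ({a, b, c, d} : Multiset ℂ) =
      (if x = a then 1 else 0) + (if x = b then 1 else 0) + (if x = c then 1 else 0) +
        (if x = d then 1 else 0) := by
  simp only [Multiset.insert_eq_cons, Multiset.count_cons, Multiset.count_singleton]
  split_ifs <;> omega

/-- **The dichotomy of a pinned doubling at one place**: two multisets of size two whose sum is
`{x, x, y, y}` are either equal (both `{a, b}`, with `a b = x y`) or scalar and distinct (`{a, a}`,
`{b, b}`, `a ≠ b`, `a b = x y`). [folklore] -/
theorem doubling_dichotomy {β β' : Multiset ℂ} {x y : ℂ} (hβ : Multiset.card β = 2)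
    (hβ' : Multiset.card β' = 2) (h : β + β' = {x, x, y, y}) :
    ∃ a b : ℂ, a * b = x * y ∧
      ((β = {a, b} ∧ β' = {a, b}) ∨ (β = {a, a} ∧ β' = {b, b} ∧ a ≠ b)) := by
  obtain ⟨u, v, rfl⟩ := Multiset.card_eq_two.mp hβ
  obtain ⟨u', v', rfl⟩ := Multiset.card_eq_two.mp hβ'
  have hsum : ({u, v} : Multiset ℂ) + {u', v'} = {u, v, u', v'} := by
    change (u ::ₘ {v}) + (u' ::ₘ {v'}) = u ::ₘ v ::ₘ u' ::ₘ {v'}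
    rw [Multiset.cons_add, Multiset.singleton_add]
  rw [hsum] at h
  have hmem : ∀ t ∈ ({u, v, u', v'} : Multiset ℂ), t = x ∨ t = y := by
    intro t ht
    rw [h] at ht
    simpa [or_assoc] using ht
  have hu := hmem u (by simp)
  have hv := hmem v (by simp)
  have hu' := hmem u' (by simp)
  have hv' := hmem v' (by simp)
  have hcx := congrArg (Multiset.count x) h
  have hcy := congrArg (Multiset.count y) h
  rw [count_four, count_four] at hcx hcy
  by_cases hxy : x = y
  · subst hxy
    simp only [or_self] at hu hv hu' hv'
    subst hu hv hu' hv'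
    exact ⟨_, _, rfl, Or.inl ⟨rfl, rfl⟩⟩
  · have hyx : ¬ y = x := fun e => hxy e.symm
    simp only [if_true, if_false, hyx] at hcx hcy
    rcases hu with rfl | rfl <;> rcases hv with rfl | rfl <;> rcases hu' with rfl | rfl <;>
      rcases hv' with rfl | rfl <;>
      simp only [if_true, if_false, hxy, hyx] at hcx hcy <;>
      first
      | omega
      | exact ⟨_, _, rfl, Or.inl ⟨rfl, rfl⟩⟩
      | exact ⟨_, _, rfl, Or.inl ⟨rfl, Multiset.pair_comm _ _⟩⟩
      | exact ⟨_, _, mul_comm _ _, Or.inl ⟨rfl, rfl⟩⟩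
      | exact ⟨_, _, mul_comm _ _, Or.inl ⟨rfl, Multiset.pair_comm _ _⟩⟩
      | exact ⟨_, _, rfl, Or.inr ⟨rfl, rfl, hxy⟩⟩
      | exact ⟨_, _, mul_comm _ _, Or.inr ⟨rfl, rfl, hyx⟩⟩

/-- **The analysis at one place.**  Let `A`, `A'` (the unitary Satake parameters at `w`, `τw`) have
two entries and `|det| = 1`, `c ≠ 0` (`c = q_w^s`), and `c A ⊔ c A' = {x, x, y, y}`.  With
`r := x y / det (c A)` (the value `ν(ϖ_w)`): if `r ≠ 1` then `A` is scalar; `|r| = 1`; and if `r = 1`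
then `c A' = c A`. [folklore] -/
theorem place_analysis {A A' : Multiset ℂ} {c x y : ℂ} (hc : c ≠ 0)
    (hA : Multiset.card A = 2) (hA' : Multiset.card A' = 2)
    (hpA : ‖A.prod‖ = 1) (hpA' : ‖A'.prod‖ = 1)
    (hsum : A.map (c * ·) + A'.map (c * ·) = {x, x, y, y}) :
    (x * y * ((A.map (c * ·)).prod)⁻¹ ≠ 1 → ∃ a : ℂ, A = {a, a}) ∧
    ‖x * y * ((A.map (c * ·)).prod)⁻¹‖ = 1 ∧
    (x * y * ((A.map (c * ·)).prod)⁻¹ = 1 → A'.map (c * ·) = A.map (c * ·)) := by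
  set t := A.map (c * ·) with ht
  set t' := A'.map (c * ·) with ht'
  have hct : Multiset.card t = 2 := by rw [ht, Multiset.card_map, hA]
  have hct' : Multiset.card t' = 2 := by rw [ht', Multiset.card_map, hA']
  have hnt : ‖t.prod‖ = ‖c‖ ^ 2 := by
    rw [ht, prod_map_const_mul_eq, hA, norm_mul, norm_pow, hpA, mul_one]
  have hnt' : ‖t'.prod‖ = ‖c‖ ^ 2 := by
    rw [ht', prod_map_const_mul_eq, hA', norm_mul, norm_pow, hpA', mul_one]
  have hc2 : ‖c‖ ^ 2 ≠ 0 := pow_ne_zero _ (norm_ne_zero_iff.mpr hc)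
  have htp : t.prod ≠ 0 := fun h0 => hc2 (by rw [← hnt, h0, norm_zero])
  obtain ⟨a, b, hab, hcase⟩ := doubling_dichotomy hct hct' hsum
  rcases hcase with ⟨hta, htb⟩ | ⟨hta, htb, hne⟩
  · -- the good case: `t = t' = {a, b}`, `r = 1`
    have hprod : t.prod = x * y := by
      rw [hta, ← hab, Multiset.insert_eq_cons, Multiset.prod_cons, Multiset.prod_singleton]
    have hr : x * y * (t.prod)⁻¹ = 1 := by rw [hprod, mul_inv_cancel₀ (hprod ▸ htp)]
    exact ⟨fun h => absurd hr h, by rw [hr, norm_one], fun _ => by rw [htb, hta]⟩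
  · -- the bad case: `t = {a, a}`, `t' = {b, b}`, `a ≠ b`, `r = b / a`
    have hprod : t.prod = a * a := by
      rw [hta, Multiset.insert_eq_cons, Multiset.prod_cons, Multiset.prod_singleton]
    have hprod' : t'.prod = b * b := by
      rw [htb, Multiset.insert_eq_cons, Multiset.prod_cons, Multiset.prod_singleton]
    have ha0 : a ≠ 0 := fun h0 => htp (by rw [hprod, h0, mul_zero])
    have hr : x * y * (t.prod)⁻¹ = b * a⁻¹ := by
      rw [← hab, hprod]
      field_simp
    have hnorm : ‖a‖ = ‖b‖ := by
      have h1 : ‖a‖ ^ 2 = ‖b‖ ^ 2 := by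
        rw [sq, sq, ← norm_mul, ← norm_mul, ← hprod, ← hprod', hnt, hnt']
      exact (pow_left_inj₀ (norm_nonneg a) (norm_nonneg b) two_ne_zero).mp h1
    refine ⟨fun _ => ?_, ?_, fun h1 => ?_⟩
    · obtain ⟨u, v, huv⟩ := Multiset.card_eq_two.mp hA
      have htuv : ({a, a} : Multiset ℂ) = {c * u, c * v} := by
        rw [← hta, ht, huv, Multiset.insert_eq_cons, Multiset.insert_eq_cons, Multiset.map_cons,
          Multiset.map_singleton]
      have hu : c * u ∈ ({a, a} : Multiset ℂ) := by rw [htuv]; simp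
      have hv : c * v ∈ ({a, a} : Multiset ℂ) := by rw [htuv]; simp
      have hu' : c * u = a := by simpa using hu
      have hv' : c * v = a := by simpa using hv
      have huv' : u = v := mul_left_cancel₀ hc (hu'.trans hv'.symm)
      exact ⟨u, by rw [huv, huv']⟩
    · rw [hr, norm_mul, norm_inv, ← hnorm, mul_inv_cancel₀ (norm_ne_zero_iff.mpr ha0)]
    · exfalso
      rw [hr, mul_inv_eq_one₀ ha0] at h1
      exact hne h1.symm

/-! ### Moduli of Hecke characters -/

/-- A Hecke character with `|ν(ϖ_w)| = 1` at one finite place is unitary: `|ν| = ‖·‖^σ` on ideles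
(`HeckeCharacter.exists_norm_apply_eq_ideleNorm_rpow`, Tate §4.3) and `‖(…, ϖ_w, …)‖ = q_w⁻¹`, so
`q_w^{-σ} = 1` forces `σ = 0`. [cite: TateThesis1967, §4.3] -/
theorem isUnitary_of_norm_valueAtUniformizer_eq_one {F : Type} [Field F] [NumberField F]
    (ν : HeckeCharacter F) (w : HeightOneSpectrum (𝓞 F)) (h : ‖ν.valueAtUniformizer w‖ = 1) :
    ν.IsUnitary := by
  obtain ⟨σ, hσ⟩ := ν.exists_norm_apply_eq_ideleNorm_rpow
  have hq1 : (1 : ℝ) < w.residueCard := by exact_mod_cast w.one_lt_residueCard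
  have hw : ‖ν.valueAtUniformizer w‖ = ((w.residueCard : ℝ))⁻¹ ^ σ := by
    rw [HeckeCharacter.valueAtUniformizer, HeckeCharacter.localComponent_apply, hσ,
      Literature.NumberTheory.GaloisRepresentations.ideleNorm_localUnits, HeckeCharacter.norm_uniformizer]
    rfl
  rw [h, Real.inv_rpow (by linarith), eq_comm, inv_eq_one] at hw
  have hσ0 : σ = 0 := by
    have hlog := congrArg Real.log hw
    rw [Real.log_rpow (by linarith), Real.log_one] at hlog
    exact (mul_eq_zero.mp hlog).resolve_right (Real.log_pos hq1).ne'
  intro x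
  rw [hσ x, hσ0, Real.rpow_zero]

/-! ### The stub -/

section Proof

variable {K : Type} [Field K] [NumberField K] {L : Type} [Field L] [NumberField L] [Algebra K L]

omit [NumberField K] in
/-- **Key step: under a pinned doubling, `t_{f,τw} = t_{f,w}` almost everywhere.** See the module
docstring for the proof. [folklore] -/
theorem eventually_satakeParam_smul_eq (τ : L ≃ₐ[K] L)
    {hL2 : isCompact_glFiniteIntegralLevel 2 L} (f : CuspidalAutomorphicRepData 2 L hL2)
    (χ : HeckeCharacter L) (hχ : HasPinnedDoubling τ f χ) :
    ∀ᶠ w : HeightOneSpectrum (𝓞 L) in cofinite, ∀ β β' : Multiset ℂ,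
      f.1.HasSatakeParamAt w β → f.1.HasSatakeParamAt (τ • w) β' → β' = β := by
  haveI : NeZero (2 : ℕ) := ⟨two_ne_zero⟩
  -- unitary normalisation in `L²`, central character, the norm cube
  obtain ⟨μ, hμ⟩ := AdelicGroupData.exists_isAutomorphicMeasure_gl_holds 2 L
  haveI := hμ
  obtain ⟨s, P, S₁, α, hS₁, hαP, hiff⟩ := CuspidalAutomorphicRepData.exists_normalisation_L2 hL2 μ f
  obtain ⟨Ω, hΩ⟩ := centralCharacter_satake_of_cuspidal f
  obtain ⟨N3, hN3⟩ := HeckeCharacter.exists_forall_apply_eq_ideleNorm_cpow L (3 : ℂ)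
  set ν : HeckeCharacter L := χ * N3 * Ω⁻¹ with hνdef
  -- the good places
  have hinj : Function.Injective fun w : HeightOneSpectrum (𝓞 L) => τ • w := MulAction.injective τ
  have hur : ∀ᶠ w : HeightOneSpectrum (𝓞 L) in cofinite, ν.IsUnramifiedAt w :=
    HeckeCharacter.isUnramifiedAt_cofinite_holds ν
  have hE : ∀ᶠ w : HeightOneSpectrum (𝓞 L) in cofinite, w ∉ S₁ ∧ τ • w ∉ S₁ ∧
      (∀ β β' : Multiset ℂ, f.1.HasSatakeParamAt w β → f.1.HasSatakeParamAt (τ • w) β' →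
        ∃ x y : ℂ, β + β' = {x, x, y, y} ∧
          χ.valueAtUniformizer w = ((w.residueCard : ℕ) : ℂ) ^ 3 * (x * y)) ∧
      (∀ β : Multiset ℂ, f.1.HasSatakeParamAt w β → Ω.valueAtUniformizer w = β.prod) ∧
      ν.IsUnramifiedAt w := by
    filter_upwards [hS₁.compl_mem_cofinite, hinj.tendsto_cofinite.eventually hS₁.compl_mem_cofinite,
      hχ, hΩ, hur] with w h1 h2 h3 h4 h5
    exact ⟨h1, h2, h3, h4, h5⟩
  set S : Set (HeightOneSpectrum (𝓞 L)) := {w | ¬ (w ∉ S₁ ∧ τ • w ∉ S₁ ∧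
      (∀ β β' : Multiset ℂ, f.1.HasSatakeParamAt w β → f.1.HasSatakeParamAt (τ • w) β' →
        ∃ x y : ℂ, β + β' = {x, x, y, y} ∧
          χ.valueAtUniformizer w = ((w.residueCard : ℕ) : ℂ) ^ 3 * (x * y)) ∧
      (∀ β : Multiset ℂ, f.1.HasSatakeParamAt w β → Ω.valueAtUniformizer w = β.prod) ∧
      ν.IsUnramifiedAt w)} with hSdef
  have hSfin : S.Finite := Filter.eventually_cofinite.mp hE
  have hS₁S : S₁ ⊆ S := fun w hw hgood => hgood.1 hw
  have hαS : IsSatakeFamilyOf P S α := hαP.mono hS₁S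
  -- the analysis at a good place
  have key : ∀ w ∉ S,
      (ν.valueAtUniformizer w ≠ 1 → ∃ a : ℂ, α w = {a, a}) ∧ ‖ν.valueAtUniformizer w‖ = 1 ∧
      (ν.valueAtUniformizer w = 1 → ∀ β β' : Multiset ℂ,
        f.1.HasSatakeParamAt w β → f.1.HasSatakeParamAt (τ • w) β' → β' = β) := by
    intro w hw
    have hgood := not_not.mp (fun h => hw h)
    obtain ⟨hw₁, hw₂, hpin, hcen, -⟩ := hgood
    set c : ℂ := (w.residueCard : ℂ) ^ s with hcdef
    have hq0 : (w.residueCard : ℂ) ≠ 0 :=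
      Nat.cast_ne_zero.2 (ne_of_gt (lt_trans zero_lt_one w.one_lt_residueCard))
    have hc : c ≠ 0 := fun h0 => hq0 ((Complex.cpow_eq_zero_iff _ _).1 h0).1
    have hqτ : (τ • w).residueCard = w.residueCard := HeightOneSpectrum.absNorm_algEquiv_smul K τ w
    -- the Satake parameters at `w` and `τ • w`
    have ht : f.1.HasSatakeParamAt w ((α w).map (c * ·)) := (hiff w hw₁ _).2 rfl
    have ht' : f.1.HasSatakeParamAt (τ • w) ((α (τ • w)).map (c * ·)) := by
      have := (hiff (τ • w) hw₂ ((α (τ • w)).map (((((τ • w).residueCard : ℕ) : ℂ) ^ s) * ·))).2 rfl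
      rwa [hqτ] at this
    obtain ⟨𝔫, -, -, ϖ, hSat⟩ := hαP w hw₁
    obtain ⟨𝔫', -, -, ϖ', hSat'⟩ := hαP (τ • w) hw₂
    obtain ⟨x, y, hsum, hχw⟩ := hpin _ _ ht ht'
    obtain ⟨hA1, hA2, hA3⟩ := place_analysis hc hSat.card_eq hSat'.card_eq hSat.norm_prod_eq_one
      hSat'.norm_prod_eq_one hsum
    -- `ν(ϖ_w) = x y / det t_{f,w}`
    have hνw : ν.valueAtUniformizer w = x * y * (((α w).map (c * ·)).prod)⁻¹ := by
      rw [hνdef, HeckeCharacter.valueAtUniformizer_mul, HeckeCharacter.valueAtUniformizer_mul,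
        HeckeCharacter.valueAtUniformizer_inv, hχw, hcen _ ht,
        HeckeCharacter.valueAtUniformizer_of_forall_apply_eq_cpow hN3 w, Complex.cpow_neg,
        show ((3 : ℂ)) = ((3 : ℕ) : ℂ) by norm_num, Complex.cpow_natCast]
      change (w.residueCard : ℂ) ^ 3 * (x * y) * ((w.residueCard : ℂ) ^ 3)⁻¹ * _ = _
      rw [mul_comm ((w.residueCard : ℂ) ^ 3) (x * y), mul_assoc (x * y),
        mul_inv_cancel₀ (pow_ne_zero _ hq0), mul_one]
    rw [hνw]
    refine ⟨hA1, hA2, fun h1 β β' hβ hβ' => ?_⟩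
    have hβe : β = (α w).map (c * ·) := (hiff w hw₁ β).1 hβ
    have hβ'e : β' = (α (τ • w)).map (c * ·) := by
      have := (hiff (τ • w) hw₂ β').1 hβ'
      rwa [hqτ] at this
    rw [hβe, hβ'e]
    exact hA3 h1
  -- if there were finitely many places the claim would be empty
  rcases finite_or_infinite (HeightOneSpectrum (𝓞 L)) with hfin | _
  · rw [Filter.cofinite_eq_bot]
    exact Filter.eventually_bot
  -- `ν` is unitary (at a good place `|ν(ϖ_w)| = 1`) and trivial (the density contradiction)
  obtain ⟨w₀, hw₀⟩ := hSfin.infinite_compl.nonempty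
  have hu : ν.IsUnitary := isUnitary_of_norm_valueAtUniformizer_eq_one ν w₀ (key w₀ hw₀).2.1
  have hν1 : ν = 1 := eq_one_of_scalar_at_ne_one P hSfin hαS hu
    (fun v hv => (not_not.mp (fun h => hv h)).2.2.2.2) (fun w hw => (key w hw).1)
  -- conclusion
  filter_upwards [hE] with w hw
  have hwS : w ∉ S := fun h => h hw
  exact (key w hwS).2.2 (by rw [hν1]; rfl)

end Proof

/-- **Stub 6 of line `Sketch`: a pinned doubling forces Galois-stable Satake data** — over the
quadratic `L/K` (`τ ≠ 1`), a cuspidal `f` on `GL₂/L` with a doubling pinned by a Hecke character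
`χ` (`HasPinnedDoubling τ f χ`) has `t_{f,w'} = t_{f,w}` for all `w' ∣ w ∩ K`, a.e. `w`
(`eventually_satakeParam_smul_eq` and `HeightOneSpectrum.eq_or_eq_smul_of_under_eq`). [folklore] -/
theorem stub_pinnedDoublingKill :
    ∀ (K : Type) [Field K] [NumberField K] (L : Type) [Field L] [NumberField L] [Algebra K L]
      (τ : L ≃ₐ[K] L), τ ≠ 1 → Module.finrank K L = 2 →
      ∀ (hL2 : isCompact_glFiniteIntegralLevel 2 L) (f : CuspidalAutomorphicRepData 2 L hL2)
        (χ : HeckeCharacter L), HasPinnedDoubling τ f χ → IsGaloisStableSatakeAE K f.1 := by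
  intro K _ _ L _ _ _ τ hτ h2 hL2 f χ hχ
  have hkey := eventually_satakeParam_smul_eq τ f χ hχ
  have hinj : Function.Injective fun w : HeightOneSpectrum (𝓞 L) => τ • w := MulAction.injective τ
  have hex : ∀ᶠ w : HeightOneSpectrum (𝓞 L) in cofinite, f.1.IsUnramifiedAt (τ • w) :=
    hinj.tendsto_cofinite.eventually f.1.hasSatakeParamAt_cofinite_holds
  filter_upwards [hkey, hex] with w hk hx
  intro w' hw' β hβ
  have hw'' : w'.under (𝓞 K) = w.under (𝓞 K) := HeightOneSpectrum.ext hw'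
  rcases HeightOneSpectrum.eq_or_eq_smul_of_under_eq h2 hτ hw'' with rfl | rfl
  · exact hβ
  · obtain ⟨β', hβ'⟩ := hx
    exact hk β β' hβ hβ' ▸ hβ'

end Summit.Langlands.Langlands.Cruxes.SelfTwistedIrreducible.DetPinning

end
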